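import Summits.SmoothPoincare4.SmoothPoincare4.Theses.SchoenfliesSplit
import Literature.Topology.FourManifolds.MorseReebSphereProofs
import Literature.Topology.FourManifolds.BallGluingUniqueness
import Literature.Topology.FourManifolds.CerfPropositionFour
import Literature.Topology.FourManifolds.CerfTheoremOne

/-!
# Disproof of `SchsplitCerf` (crux stmt-SmoothPoincare4-8758) — standing adversary's work file

`SchsplitCerf` (route SchoenfliesSplit, support item, rank 9) is VERBATIM the named fact
`Literature.Topology.FourManifolds.cerf_twistedSphere_four`: every twisted 4-sphere
`T : TwistedSphere 3 φ` (a compact Hausdorff second-countable smooth 4-manifold which is the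
boundary gluing `𝔻⁴ ∪_φ 𝔻⁴` of two closed 4-discs along a diffeomorphism `φ` of `𝕊³`) is
diffeomorphic to the round `𝕊⁴ ⊆ ℝ⁵`.  Cerf (1968), `Γ₄ = 0`.

## Findings (cycle 1, 2026-08-16) — NO KILL; the statement is a theorem of 1968

* §0  `SchsplitCerf ↔ cerf_twistedSphere_four` by `Iff.rfl`; the instance binder
  `∀ [Fact (isSmoothEmbedding_sphereInclusion' 3)]` is dischargeable (global instance
  `fact_isSmoothEmbedding_sphereInclusion'`), so it hides no vacuity; the bundle's fields
  `compactSpace` / `secondCountableTopology` are redundant (`schsplitCerf_iff_unbundled`).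
* §1  WHY IT RESISTS (kernel-checked): `SmoothPoincare4 → SchsplitCerf`
  (`schsplitCerf_of_smoothPoincare4`), because the tree PROVES that every twisted sphere is
  HOMEOMORPHIC to `𝕊⁴` (`IsTwistedSphere.nonempty_homeomorph_sphere`, Alexander trick).  Hence a
  counterexample to the crux is an exotic 4-sphere (`existsExoticFourSphere_of_not_schsplitCerf`):
  no junk model of `TwistedSphere 3 φ` exists — the interface pins the topology completely, and
  the smooth structure is a smooth structure on the topological 4-sphere.  Cheap refutation is
  therefore exactly as hard as ¬SPC4.
* §2  HOW MUCH IS ALREADY PROVED (for the provers): the crux holds UNCONDITIONALLY for every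
  `φ` that extends to a diffeomorphism of `𝔻⁴` (`schsplitCerf_of_extendsOverBall`), in
  particular for `φ = id`, for every restriction of an element of `O(4)` and for every `φ`
  diffeotopic to one of these (`schsplitCerf_at_refl`, `schsplitCerf_at_sphereCongr`,
  `schsplitCerf_of_dichotomy_pointwise`).  The whole crux follows from the single leaf
  `cerf_pi0DiffDisc_relBoundary_three` (`π₀ Diff(D³ rel ∂) = 0`, Cerf Ch. II–VI / Hatcher 1983)
  (`schsplitCerf_of_relBoundary`), equivalently from Cerf's Théorème 1
  (`schsplitCerf_of_pi0Diff`).  So the ONLY open content is `π₀`-level: "every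
  orientation-preserving diffeomorphism of `𝕊³` is diffeotopic to the identity".  The same formal
  statement in dimension 2 is a theorem of the tree (`schsplitCerf_analogue_dim_two`, `Γ₂ = 0`),
  so the gluing formalism itself is faithful and non-vacuous.
* §3  LOAD-BEARING HYPOTHESES.  (a) the gluing predicate is everything: dropping
  `isTwistedSphere` ("every compact smooth 4-manifold is `𝕊⁴`") is false — minimal junk witness
  the empty manifold (`schsplitCerf_false_without_gluing`).  (b) The seam / smoothness clauses
  cannot be dropped CHEAPLY-refutably: any `P` covered by two topologically embedded 4-discs is
  still a homotopy 4-sphere, so every weakening of the embedding/seam data is again refutable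
  only by an exotic `𝕊⁴`.  KERNEL-CHECKED for the smoothness data (§3d: gluing two discs by
  continuous injections along a mere HOMEOMORPHISM of `𝕊³` is still implied by the summit,
  `schsplitCerfTopologicalGluing_of_smoothPoincare4`, and implies the crux); PAPER for deleting the
  seam relation (two topological balls covering a closed 4-manifold: cup-length ≤ 1 + free π₁ +
  perfect ⇒ homotopy sphere ⇒ Freedman).  (c) The COVER clause
  `range jA ∪ range jB = univ` IS load-bearing with a cheap witness: `𝕊⁴ ⊔ 𝕊⁴` with the two
  hemispheres of the first summand (`schsplitCerf_false_without_cover`, kernel-checked; on the way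
  `isSmoothEmbedding_inl_comp` fills Mathlib's `proof_wanted IsSmoothEmbedding.comp` for
  `Sum.inl ∘ f`).  Inside a connected `P` the clause is automatic, so (c) says exactly: any proof
  must use connectedness of the glued manifold.
* §4  NATURAL STRENGTHENINGS THAT ARE FALSE (kernel-checked): (i) the orientation-naive reading
  of Cerf's Théorème 1, "every diffeomorphism of `𝕊³` is diffeotopic to the identity", is false
  (`not_forall_isDiffeotopicToId_sphere_three`: a hyperplane reflection reverses orientation) —
  yet the crux survives it because reflections extend LINEARLY over `𝔻⁴`; any proof by isotopy
  must split by orientation class.  (ii) "the identification `T ≅ 𝕊⁴` is unique" is false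
  (`not_subsingleton_diffeomorph_sphere_four`: `id ≠` reflection), which is why gluing
  uniqueness (`nonempty_diffeomorph_of_isTwistedSphere`) is a genuine theorem and not a
  canonical map.  (iii) The dimension-free strengthening "every twisted `(n+1)`-sphere is
  standard" is false at `n = 6` (Milnor 1956; Kervaire–Milnor 1963: `Γ₇ = ℤ/28`): any proof must
  use `n = 3` (Smale conjecture / Cerf), not gluing formalism alone — not formalisable here.
* §5  OPEN ADVERSARIAL DIRECTIONS (none is a kill; all are information for provers):
  (i) the converse `SchsplitCerf → cerf_diffeomorph_sphere_three_extends_ball` (needs the Palais /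
  Cerf disc theorem to normalise one disc; would show the crux is EQUIVALENT to `Γ₄ = 0` in
  extension form, i.e. the route cannot dodge Cerf); (ii) the leaf `cerf_pi0DiffDisc_relBoundary_three`
  read adversarially: support in the CLOSED unit ball, isotopy through such diffeomorphisms — true
  (radial conjugation `s_λ(y) = λ s(y/λ)` shrinks the support into the open ball, then Cerf/Hatcher),
  no misstatement found; its 1-dimensional analogue is proved in the tree.
  LANDED under `Theorems/SchsplitCerf/Negative/` (all ACCEPTED 2026-08-16): `RefutationCost.lean`
  (p76259: `not_smoothPoincare4_of_not_schsplitCerf`, `existsExoticFourSphere_of_not_schsplitCerf`),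
  `WithoutGluingFalse.lean` (p79359), `WithoutCoverFalse.lean` (p81436, incl. `isSmoothEmbedding_inl_comp`),
  `NaiveStrengtheningsFalse.lean` (p79856), `TopologicalGluingCost.lean` (p81527) — importable by
  ideators / planners / the lead.

Nothing in this file asserts a Theses decl positively except under a hypothesis; the file is the
disprover's evidence, not a landing.
-/

noncomputable section

set_option linter.dupNamespace false

namespace Summit.SmoothPoincare4.SmoothPoincare4.Cruxes.SchsplitCerf.Disproof

open scoped Manifold ContDiff Topology
open Set Function
open Literature.Topology.FourManifolds
open Summit.SmoothPoincare4.SmoothPoincare4.Theses.SchoenfliesSplit (SchsplitCerf)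

/-- Local notation: `𝔼 n` is the model Euclidean space `EuclideanSpace ℝ (Fin n)`. -/
local notation "𝔼 " n:arg => EuclideanSpace ℝ (Fin n)
/-- Local notation for the unit sphere `𝕊ⁿ ⊆ ℝⁿ⁺¹`. -/
local notation "𝕊 " n:arg => (Metric.sphere (0 : EuclideanSpace ℝ (Fin (n + 1))) 1)

/-! ## §0 The crux is verbatim the named fact; the `Fact` binder is dischargeable -/

/-- `SchsplitCerf` is, definitionally, the named fact `cerf_twistedSphere_four`
(`CerfGammaFour.lean`). [cite: CerfDiffeoSphere1968, Ch. I §1, Corollaire 1] -/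
theorem schsplitCerf_iff_cerf_twistedSphere_four : SchsplitCerf ↔ cerf_twistedSphere_four :=
  Iff.rfl

/-- The instance binder of the crux is inhabited globally (proved in `ClosedBall.lean`), so the
leading `∀ [Fact …]` hides no vacuity. [folklore] -/
theorem fact_sphereInclusion_three : Fact (isSmoothEmbedding_sphereInclusion' 3) :=
  inferInstance

/-- Binder-free form of the crux: equivalent to the crux (the `Fact` is a `Prop`, so all its
instances are definitionally equal). [folklore] -/
theorem schsplitCerf_iff_binderFree :
    SchsplitCerf ↔ ∀ (φ : (𝕊 3) ≃ₘ⟮𝓡 3, 𝓡 3⟯ (𝕊 3)) (T : TwistedSphere 3 φ),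
      Nonempty (T.carrier ≃ₘ⟮𝓡 4, 𝓡 4⟯ (𝕊 4)) :=
  ⟨fun h φ T => h φ T, fun h _ φ T => h φ T⟩

/-- **Binder hygiene**: the fields `compactSpace` and `secondCountableTopology` of
`TwistedSphere 3 φ` are REDUNDANT — both follow from the gluing predicate (two compact discs cover;
a compact charted space is second countable).  So the crux is equivalent to its unbundled form over
Hausdorff smooth 4-manifolds `P` with `IsTwistedSphere 3 φ P` and nothing else; provers constructing
a `TwistedSphere` need not supply compactness / second countability by hand. [folklore] -/
theorem schsplitCerf_iff_unbundled :
    SchsplitCerf ↔ ∀ (φ : (𝕊 3) ≃ₘ⟮𝓡 3, 𝓡 3⟯ (𝕊 3)) (P : Type) [TopologicalSpace P] [T2Space P]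
      [ChartedSpace (𝔼 4) P] [IsManifold (𝓡 4) ∞ P],
      IsTwistedSphere 3 φ P → Nonempty (P ≃ₘ⟮𝓡 4, 𝓡 4⟯ (𝕊 4)) := by
  constructor
  · intro h φ P _ _ _ _ hP
    haveI : CompactSpace P := hP.compactSpace
    haveI : SecondCountableTopology P :=
      ChartedSpace.secondCountable_of_sigmaCompact (EuclideanSpace ℝ (Fin 4)) P
    exact h φ { carrier := P, isTwistedSphere := hP }
  · intro h _ φ T
    exact h φ T.carrier T.isTwistedSphere

/-! ## §1 Why it resists: a counterexample is an exotic 4-sphere -/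

/-- **Every twisted 4-sphere is a topological 4-sphere** (tree theorem, Alexander trick), restated
for the bundled type. [cite: Milnor1963, Thm. 4.1 (proof, p. 25)] -/
theorem nonempty_homeomorph_sphere {φ : (𝕊 3) ≃ₘ⟮𝓡 3, 𝓡 3⟯ (𝕊 3)} (T : TwistedSphere 3 φ) :
    Nonempty (T.carrier ≃ₜ (𝕊 4)) :=
  T.isTwistedSphere.nonempty_homeomorph_sphere

/-- **The summit implies the crux**: under `SmoothPoincare4` every twisted 4-sphere, being a smooth
4-manifold homotopy equivalent (indeed homeomorphic) to `𝕊⁴`, is diffeomorphic to `𝕊⁴`.  Hence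
`¬ SchsplitCerf → ¬ SmoothPoincare4`: refuting this crux means producing an exotic `𝕊⁴`. [folklore] -/
theorem schsplitCerf_of_smoothPoincare4 (h : _root_.SmoothPoincare4) : SchsplitCerf := by
  intro _ φ T
  obtain ⟨e⟩ := nonempty_homeomorph_sphere T
  exact h T.carrier T.chartedSpace T.isManifold e.toHomotopyEquiv

/-- Contrapositive of `schsplitCerf_of_smoothPoincare4`. [folklore] -/
theorem not_smoothPoincare4_of_not_schsplitCerf (h : ¬ SchsplitCerf) : ¬ _root_.SmoothPoincare4 :=
  fun hs => h (schsplitCerf_of_smoothPoincare4 hs)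

/-- **A counterexample to the crux is an exotic 4-sphere** in the tree's sense
`ExistsExoticFourSphere` (`SPC4Wave0.lean`): the carrier of a non-standard twisted sphere is a
smooth 4-manifold homeomorphic but not diffeomorphic to `𝕊⁴`. [folklore] -/
theorem existsExoticFourSphere_of_not_schsplitCerf (h : ¬ SchsplitCerf) :
    ExistsExoticFourSphere := by
  simp only [schsplitCerf_iff_binderFree, not_forall, not_nonempty_iff] at h
  obtain ⟨φ, T, hT⟩ := h
  obtain ⟨e⟩ := nonempty_homeomorph_sphere T
  exact ⟨T.carrier, inferInstance, T.chartedSpace, T.isManifold, e, hT⟩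

/-! ## §2 What is already proved toward the crux (conditional / special cases) -/

/-- The crux from the single leaf `π₀ Diff(D³ rel ∂) = 0` (tree chain
`cerf_twistedSphere_four_of_relBoundary`). [cite: CerfDiffeoSphere1968, Ch. I §2, (2)] -/
theorem schsplitCerf_of_relBoundary (h : cerf_pi0DiffDisc_relBoundary_three) : SchsplitCerf :=
  cerf_twistedSphere_four_of_relBoundary h

/-- The crux from Cerf's Théorème 1 (`π₀ Diff 𝕊³ = ℤ/2`, orientation-free dichotomy form).
[cite: CerfDiffeoSphere1968, Ch. I §1, Théorème 1] -/
theorem schsplitCerf_of_pi0Diff (h : cerf_pi0Diff_sphere_three) : SchsplitCerf :=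
  cerf_twistedSphere_four_of_pi0Diff' h

/-- The crux from Cerf's theorem in extension form (every `φ` extends over `𝔻⁴`), with all gluing
facts discharged by the tree. [cite: CerfDiffeoSphere1968, Ch. I §1, Corollaire 1] -/
theorem schsplitCerf_of_extends (h : cerf_diffeomorph_sphere_three_extends_ball) : SchsplitCerf :=
  cerf_twistedSphere_four_of_extends'' h

/-- The crux from Cerf's Théorème 1 AS PRINTED: every orientation-preserving diffeomorphism of
`𝕊³` is diffeotopic to the identity (tree chain; the tree moreover proves the leaf
`cerf_pi0DiffDisc_relBoundary_three` EQUIVALENT to this statement,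
`cerf_pi0DiffDisc_relBoundary_three_iff_forall_isOrientationPreserving`, so the leaf carries no
slack of its own). [cite: CerfDiffeoSphere1968, Ch. I §1, Théorème 1] -/
theorem schsplitCerf_of_forall_isOrientationPreserving
    (h : ∀ (o : SmoothOrientation (𝓡 3) (𝕊 3)) (φ : (𝕊 3) ≃ₘ⟮𝓡 3, 𝓡 3⟯ (𝕊 3)),
      φ.IsOrientationPreserving o o → Diffeomorph.IsDiffeotopicToId φ) : SchsplitCerf :=
  cerf_twistedSphere_four_of_forall_isOrientationPreserving h

/-- **Pointwise unconditional case**: the crux instance holds for every gluing map that extends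
to a diffeomorphism of `𝔻⁴`. [cite: KervaireMilnorAnnals1963, §1] -/
theorem schsplitCerf_of_extendsOverBall {φ : (𝕊 3) ≃ₘ⟮𝓡 3, 𝓡 3⟯ (𝕊 3)}
    (hφ : ExtendsOverBall 3 φ) (T : TwistedSphere 3 φ) :
    Nonempty (T.carrier ≃ₘ⟮𝓡 4, 𝓡 4⟯ (𝕊 4)) :=
  T.nonempty_diffeomorph_sphere_of_extendsOverBall'' hφ

/-- The untwisted case `φ = id` of the crux holds unconditionally. [folklore] -/
theorem schsplitCerf_at_refl (T : TwistedSphere 3 (Diffeomorph.refl (𝓡 3) (𝕊 3) ∞)) :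
    Nonempty (T.carrier ≃ₘ⟮𝓡 4, 𝓡 4⟯ (𝕊 4)) :=
  schsplitCerf_of_extendsOverBall (extendsOverBall_refl 3) T

/-- The crux holds unconditionally for every gluing map which is the restriction of a linear
isometry of `ℝ⁴` (all of `O(4)`, both orientation classes). [folklore] -/
theorem schsplitCerf_at_sphereCongr (A : 𝔼 4 ≃ₗᵢ[ℝ] 𝔼 4) (T : TwistedSphere 3 (sphereCongr A)) :
    Nonempty (T.carrier ≃ₘ⟮𝓡 4, 𝓡 4⟯ (𝕊 4)) :=
  schsplitCerf_of_extendsOverBall (extendsOverBall_sphereCongr A) T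

/-- The crux holds unconditionally for hyperplane reflections (orientation-reversing). [folklore] -/
theorem schsplitCerf_at_sphereReflection (v : 𝕊 3) (T : TwistedSphere 3 (sphereReflection v)) :
    Nonempty (T.carrier ≃ₘ⟮𝓡 4, 𝓡 4⟯ (𝕊 4)) :=
  schsplitCerf_of_extendsOverBall (extendsOverBall_sphereReflection v) T

/-- **Pointwise dichotomy form**: the crux instance at `φ` holds as soon as `φ` is diffeotopic to
the identity or to a hyperplane reflection.  Cerf's Théorème 1 says every `φ` is. So the residual
open content of the crux is exactly `π₀`-information about `Diff(𝕊³)`.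
[cite: CerfDiffeoSphere1968, Ch. I §1, Lemme 2] -/
theorem schsplitCerf_of_dichotomy_pointwise (v : 𝕊 3) {φ : (𝕊 3) ≃ₘ⟮𝓡 3, 𝓡 3⟯ (𝕊 3)}
    (h : Diffeomorph.IsDiffeotopicToId φ ∨ Diffeomorph.IsDiffeotopic (sphereReflection v) φ)
    (T : TwistedSphere 3 φ) : Nonempty (T.carrier ≃ₘ⟮𝓡 4, 𝓡 4⟯ (𝕊 4)) := by
  rcases h with hφ | hφ
  · exact schsplitCerf_of_extendsOverBall (ExtendsOverBall.of_isDiffeotopicToId hφ) T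
  · exact schsplitCerf_of_extendsOverBall
      (ExtendsOverBall.of_isDiffeotopic_sphereReflection v hφ) T

/-- **Dimensional sanity check (the formalism is right and non-vacuous)**: the SAME formal
statement two dimensions down — every twisted 2-sphere `D² ∪_φ D²` is diffeomorphic to `𝕊²` — is a
THEOREM of the tree with no hypothesis (`Γ₂ = 0`: `π₀ Diff(𝕊¹)` dichotomy proved, radial
extension, gluing uniqueness).  So `SchsplitCerf` is exactly as hard as its `π₀ Diff(𝕊³)` input and
the typed gluing formalism adds no obstruction of its own. [cite: CerfDiffeoSphere1968, Ch. I §1, Lemme 2] -/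
theorem schsplitCerf_analogue_dim_two (φ : (𝕊 1) ≃ₘ⟮𝓡 1, 𝓡 1⟯ (𝕊 1)) (T : TwistedSphere 1 φ) :
    Nonempty (T.carrier ≃ₘ⟮𝓡 2, 𝓡 2⟯ (𝕊 2)) :=
  T.nonempty_diffeomorph_sphere_two

/-! ## §3 Load-bearing hypotheses -/

/-- **The crux with the gluing hypothesis dropped**: "every compact Hausdorff second-countable
smooth 4-manifold is diffeomorphic to `𝕊⁴`" (all the structure fields of `TwistedSphere 3 φ`
except `isTwistedSphere`). [folklore] -/
def SchsplitCerfWithoutGluing : Prop :=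
  ∀ (M : Type) [TopologicalSpace M] [T2Space M] [SecondCountableTopology M] [CompactSpace M]
    [ChartedSpace (𝔼 4) M] [IsManifold (𝓡 4) ∞ M], Nonempty (M ≃ₘ⟮𝓡 4, 𝓡 4⟯ (𝕊 4))

/-- Any proof of the crux must use the gluing predicate: without it the statement is false,
minimal junk witness the EMPTY 4-manifold (Mathlib's `ChartedSpace.empty`). [folklore] -/
theorem schsplitCerf_false_without_gluing : ¬ SchsplitCerfWithoutGluing := by
  intro h
  letI : ChartedSpace (𝔼 4) Empty := ChartedSpace.empty _ _
  obtain ⟨e⟩ := h Empty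
  have p : 𝕊 4 := ⟨EuclideanSpace.single 0 1, by simp⟩
  exact (e.symm p).elim

/-! ### §3b Smooth embeddings into a disjoint union (fills Mathlib's `proof_wanted
IsSmoothEmbedding.comp` in the special case `Sum.inl ∘ f`) -/

section SumEmbedding

universe u

variable {EM : Type*} [NormedAddCommGroup EM] [NormedSpace ℝ EM] {HM : Type*}
  [TopologicalSpace HM] {I : ModelWithCorners ℝ EM HM}
  {EN : Type u} [NormedAddCommGroup EN] [NormedSpace ℝ EN] {HN : Type*} [TopologicalSpace HN]
  {J : ModelWithCorners ℝ EN HN}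
  {M : Type*} [TopologicalSpace M] [ChartedSpace HM M]
  {N N' : Type*} [TopologicalSpace N] [ChartedSpace HN N] [TopologicalSpace N']
  [ChartedSpace HN N'] {n : ℕ∞ω}

/-- A chart of the maximal `C^n` atlas of `N`, lifted along `Sum.inl`, lies in the maximal atlas of
`N ⊕ N'` (Mathlib proves this only for charts of the atlas itself, inside
`IsManifold.disjointUnion`). [folklore] -/
theorem mem_maximalAtlas_lift_inl [Nonempty HN] [IsManifold J n N] [IsManifold J n N']
    {e : OpenPartialHomeomorph N HN} (he : e ∈ IsManifold.maximalAtlas J n N) :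
    e.lift_openEmbedding (X' := N ⊕ N') Topology.IsOpenEmbedding.inl ∈
      IsManifold.maximalAtlas J n (N ⊕ N') := by
  rw [IsManifold.mem_maximalAtlas_iff, mem_maximalAtlas_iff]
  intro e' he'
  obtain (⟨f, hf, rfl⟩ | ⟨f, hf, rfl⟩) := ChartedSpace.mem_atlas_sum he'
  · rw [e.lift_openEmbedding_trans f Topology.IsOpenEmbedding.inl,
      f.lift_openEmbedding_trans e Topology.IsOpenEmbedding.inl]
    exact ⟨IsManifold.compatible_of_mem_maximalAtlas he (IsManifold.subset_maximalAtlas hf),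
      IsManifold.compatible_of_mem_maximalAtlas (IsManifold.subset_maximalAtlas hf) he⟩
  · constructor
    · apply ContDiffGroupoid.mem_of_source_eq_empty
      ext x
      exact ⟨fun ⟨hx₁, hx₂⟩ => by simp_all, fun hx => hx.elim⟩
    · apply ContDiffGroupoid.mem_of_source_eq_empty
      ext x
      exact ⟨fun ⟨hx₁, hx₂⟩ => by simp_all, fun hx => hx.elim⟩

/-- **Post-composition of an immersion (with chosen complement) with `Sum.inl`.** Keep the domain
chart and the linear normal form; lift the codomain chart along the open embedding `Sum.inl`.
[folklore] -/
theorem isImmersionAtOfComplement_inl_comp [Nonempty HN] [IsManifold J n N] [IsManifold J n N']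
    {F : Type*} [NormedAddCommGroup F] [NormedSpace ℝ F] {f : M → N} {x : M}
    (h : Manifold.IsImmersionAtOfComplement F I J n f x) :
    Manifold.IsImmersionAtOfComplement F I J n (Sum.inl ∘ f : M → N ⊕ N') x := by
  refine Manifold.IsImmersionAtOfComplement.mk_of_charts h.equiv h.domChart
    (h.codChart.lift_openEmbedding Topology.IsOpenEmbedding.inl) h.mem_domChart_source
    ⟨f x, h.mem_codChart_source, rfl⟩ h.domChart_mem_maximalAtlas
    (mem_maximalAtlas_lift_inl h.codChart_mem_maximalAtlas)
    (fun y hy => ⟨f y, h.source_subset_preimage_source hy, rfl⟩) ?_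
  intro u hu
  have key := h.writtenInCharts hu
  simp only [Function.comp_apply, OpenPartialHomeomorph.extend_coe] at key ⊢
  rw [OpenPartialHomeomorph.lift_openEmbedding_apply]
  exact key

/-- **A smooth embedding followed by `Sum.inl` is a smooth embedding** into the disjoint union.
[folklore] -/
theorem isSmoothEmbedding_inl_comp [Nonempty HN] [IsManifold J n N] [IsManifold J n N']
    {f : M → N} (h : Manifold.IsSmoothEmbedding I J n f) :
    Manifold.IsSmoothEmbedding I J n (Sum.inl ∘ f : M → N ⊕ N') := by
  obtain ⟨⟨F, _, _, hF⟩, hemb⟩ := h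
  exact ⟨⟨F, _, _, fun x => isImmersionAtOfComplement_inl_comp (hF x)⟩,
    Topology.IsEmbedding.inl.comp hemb⟩

end SumEmbedding

/-! ### §3c The cover clause is load-bearing: witness `𝕊⁴ ⊔ 𝕊⁴` -/

/-- `𝕊⁴ ⊔ 𝕊⁴` is not diffeomorphic (not even homeomorphic) to `𝕊⁴`: the sphere is connected, the
disjoint union is not. [folklore] -/
theorem isEmpty_diffeomorph_sum_sphere_four :
    IsEmpty (((𝕊 4) ⊕ (𝕊 4)) ≃ₘ⟮𝓡 4, 𝓡 4⟯ (𝕊 4)) := by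
  refine ⟨fun e => ?_⟩
  have hrank : 1 < Module.rank ℝ (𝔼 5) := by
    rw [← Module.finrank_eq_rank, finrank_euclideanSpace_fin]
    exact_mod_cast (by norm_num : (1 : ℕ) < 5)
  haveI : PreconnectedSpace (𝕊 4) :=
    Subtype.preconnectedSpace (isPreconnected_sphere hrank (0 : 𝔼 5) 1)
  have hpre : IsPreconnected (Set.univ : Set ((𝕊 4) ⊕ (𝕊 4))) := by
    have himg := (isPreconnected_univ (α := 𝕊 4)).image e.toHomeomorph.symm
      e.toHomeomorph.symm.continuous.continuousOn
    rwa [Set.image_univ, EquivLike.range_eq_univ] at himg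
  haveI : PreconnectedSpace ((𝕊 4) ⊕ (𝕊 4)) := ⟨hpre⟩
  have p : 𝕊 4 := ⟨EuclideanSpace.single 0 1, by simp⟩
  have huniv : Set.range (Sum.inl : (𝕊 4) → (𝕊 4) ⊕ (𝕊 4)) = Set.univ :=
    isClopen_range_inl.eq_univ ⟨Sum.inl p, p, rfl⟩
  have hmem : (Sum.inr p : (𝕊 4) ⊕ (𝕊 4)) ∈ Set.range (Sum.inl : (𝕊 4) → (𝕊 4) ⊕ (𝕊 4)) := by
    rw [huniv]; exact Set.mem_univ _
  obtain ⟨q, hq⟩ := hmem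
  exact Sum.inl_ne_inr hq

/-- **The crux with the COVER clause dropped** (`range jA ∪ range jB = univ` removed from
`IsClosedGluing`; everything else — compactness, the two smooth disc embeddings, the seam
relation along `φ` — kept). [folklore] -/
def SchsplitCerfWithoutCover : Prop :=
  ∀ (φ : (𝕊 3) ≃ₘ⟮𝓡 3, 𝓡 3⟯ (𝕊 3)) (P : Type) [TopologicalSpace P] [T2Space P]
    [SecondCountableTopology P] [CompactSpace P] [ChartedSpace (𝔼 4) P] [IsManifold (𝓡 4) ∞ P],
    (∃ jA jB : (Metric.closedBall (0 : 𝔼 4) 1) → P,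
      Manifold.IsSmoothEmbedding (𝓡∂ 4) (𝓡 4) ∞ jA ∧ Manifold.IsSmoothEmbedding (𝓡∂ 4) (𝓡 4) ∞ jB ∧
      ∀ a b, jA a = jB b ↔ ∃ z, a = (closedBallBoundaryData 3).incl z ∧
        b = (closedBallBoundaryData 3).incl (φ z)) →
    Nonempty (P ≃ₘ⟮𝓡 4, 𝓡 4⟯ (𝕊 4))

/-- **Any proof of the crux must use the cover clause**: the two hemispheres of the first summand
of `𝕊⁴ ⊔ 𝕊⁴` are smoothly embedded 4-discs meeting exactly along the identity of their boundary
spheres, yet `𝕊⁴ ⊔ 𝕊⁴ ≇ 𝕊⁴`.  (Inside a CONNECTED `P` the clause is automatic: the union of the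
two discs is a closed 4-manifold, open in `P` by invariance of domain — paper remark.) [folklore] -/
theorem schsplitCerf_false_without_cover : ¬ SchsplitCerfWithoutCover := by
  intro h
  obtain ⟨jA, jB, hA, hB, -, hR⟩ :=
    (isTwistedSphere_refl_sphere (isDouble_sphere_holds (n := 3)) :
      IsTwistedSphere 3 (Diffeomorph.refl (𝓡 3) (𝕊 3) ∞) (𝕊 4))
  obtain ⟨e⟩ := h (Diffeomorph.refl (𝓡 3) (𝕊 3) ∞) ((𝕊 4) ⊕ (𝕊 4))
    ⟨Sum.inl ∘ jA, Sum.inl ∘ jB, isSmoothEmbedding_inl_comp hA, isSmoothEmbedding_inl_comp hB,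
      fun a b => by rw [Function.comp_apply, Function.comp_apply, Sum.inl_injective.eq_iff]
                    exact hR a b⟩
  exact isEmpty_diffeomorph_sum_sphere_four.false e

/-! ### §3d Deleting ALL smoothness of the gluing data does not make the crux refutable -/

/-- **The crux with every smoothness requirement on the gluing data deleted**: glue two closed
4-discs by merely CONTINUOUS INJECTIVE maps covering `P` and meeting exactly along an arbitrary
HOMEOMORPHISM `σ` of `𝕊³`; conclude that the ambient smooth 4-manifold `P` is diffeomorphic to
`𝕊⁴`.  (Much weaker hypotheses than `TwistedSphere 3 φ`.) [folklore] -/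
def SchsplitCerfTopologicalGluing : Prop :=
  ∀ (σ : (𝕊 3) ≃ₜ (𝕊 3)) (P : Type) [TopologicalSpace P] [T2Space P] [SecondCountableTopology P]
    [ChartedSpace (𝔼 4) P] [IsManifold (𝓡 4) ∞ P],
    (∃ jA jB : (Metric.closedBall (0 : 𝔼 4) 1) → P, Continuous jA ∧ Continuous jB ∧
      Injective jA ∧ Injective jB ∧ range jA ∪ range jB = univ ∧
      ∀ a b, jA a = jB b ↔ ∃ z : 𝕊 3, a = Set.inclusion Metric.sphere_subset_closedBall z ∧
        b = Set.inclusion Metric.sphere_subset_closedBall (σ z)) →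
    Nonempty (P ≃ₘ⟮𝓡 4, 𝓡 4⟯ (𝕊 4))

/-- **Even the topological-gluing version is a consequence of the summit**: a two-disc cover in
the topological sense already forces `P ≃ₜ 𝕊⁴` (tree: `TwoDiscCover.homeomorphSphere`, Alexander
trick), so `SmoothPoincare4` applies.  Hence weakening the smooth-embedding / diffeomorphism
hypotheses of the crux does not produce a cheaply refutable statement either: every such
weakening is sandwiched between the summit and the crux. [cite: Milnor1963, Thm. 4.1 (proof, p. 25)] -/
theorem schsplitCerfTopologicalGluing_of_smoothPoincare4 (h : _root_.SmoothPoincare4) :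
    SchsplitCerfTopologicalGluing := by
  intro σ P _ _ _ _ _ hP
  obtain ⟨jA, jB, hcA, hcB, hiA, hiB, hU, hR⟩ := hP
  let C : TwoDiscCover 3 P :=
    { σ := σ, jA := jA, jB := jB, continuous_jA := hcA, continuous_jB := hcB,
      injective_jA := hiA, injective_jB := hiB, range_union := hU, apply_eq_apply_iff := hR }
  haveI : CompactSpace P :=
    ⟨by rw [← hU]; exact (isCompact_range hcA).union (isCompact_range hcB)⟩
  exact h P inferInstance inferInstance C.homeomorphSphere.toHomotopyEquiv

/-- The topological-gluing version implies the crux (forget smoothness of the data). [folklore] -/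
theorem schsplitCerf_of_schsplitCerfTopologicalGluing (h : SchsplitCerfTopologicalGluing) :
    SchsplitCerf := by
  intro _ φ T
  obtain ⟨jA, jB, hA, hB, hU, hR⟩ := T.isTwistedSphere
  exact h φ.toHomeomorph T.carrier ⟨jA, jB, hA.isEmbedding.continuous, hB.isEmbedding.continuous,
    hA.isEmbedding.injective, hB.isEmbedding.injective, hU,
    fun a b => by simpa [closedBallBoundaryData_incl] using hR a b⟩

/-- Sandwich, contrapositive form: refuting the topological-gluing weakening is still refuting the
summit. [folklore] -/
theorem not_smoothPoincare4_of_not_schsplitCerfTopologicalGluing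
    (h : ¬ SchsplitCerfTopologicalGluing) : ¬ _root_.SmoothPoincare4 :=
  fun hs => h (schsplitCerfTopologicalGluing_of_smoothPoincare4 hs)

/-! ## §4 Natural strengthenings that are false -/

/-- **The orientation-naive strengthening of Cerf's Théorème 1 is false**: not every
self-diffeomorphism of `𝕊³` is diffeotopic to the identity (a hyperplane reflection reverses
orientation; tree theorem `not_isDiffeotopicToId_sphereReflection`).  The crux survives this only
because reflections extend linearly over `𝔻⁴` (`schsplitCerf_at_sphereReflection`).
[cite: HirschDT1976, Ch. 8 §1, Exercise 7(a)] -/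
theorem not_forall_isDiffeotopicToId_sphere_three :
    ¬ ∀ φ : (𝕊 3) ≃ₘ⟮𝓡 3, 𝓡 3⟯ (𝕊 3), Diffeomorph.IsDiffeotopicToId φ := by
  intro h
  have v : 𝕊 3 := ⟨EuclideanSpace.single 0 1, by simp⟩
  exact not_isDiffeotopicToId_sphereReflection (n := 3) (by norm_num) v (h _)

/-- **The identification `T ≅ 𝕊⁴` is never unique**: already for the round sphere there are two
distinct self-diffeomorphisms (identity and a hyperplane reflection), so the strengthening of the
crux to `Subsingleton (T.carrier ≃ₘ 𝕊⁴)` / "canonical diffeomorphism" is false. [folklore] -/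
theorem not_subsingleton_diffeomorph_sphere_four :
    ¬ Subsingleton ((𝕊 4) ≃ₘ⟮𝓡 4, 𝓡 4⟯ (𝕊 4)) := by
  intro h
  let v : 𝕊 4 := ⟨EuclideanSpace.single 0 1, by simp⟩
  have hfix : sphereReflection v v = v := by
    rw [Subsingleton.elim (sphereReflection v) (Diffeomorph.refl (𝓡 4) (𝕊 4) ∞)]; rfl
  rw [sphereReflection_eq_self_iff, real_inner_self_eq_norm_sq, norm_eq_of_mem_sphere] at hfix
  norm_num at hfix

/-- The same for an arbitrary twisted sphere structure on the round sphere: the untwisted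
`TwistedSphere.sphere` has two distinct identifications with `𝕊⁴`. [folklore] -/
theorem not_forall_subsingleton_diffeomorph :
    ¬ ∀ (φ : (𝕊 3) ≃ₘ⟮𝓡 3, 𝓡 3⟯ (𝕊 3)) (T : TwistedSphere 3 φ),
      Subsingleton (T.carrier ≃ₘ⟮𝓡 4, 𝓡 4⟯ (𝕊 4)) := fun h =>
  not_subsingleton_diffeomorph_sphere_four (h _ (TwistedSphere.sphere isDouble_sphere_holds))

end Summit.SmoothPoincare4.SmoothPoincare4.Cruxes.SchsplitCerf.Disproof

end
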